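import Literature.GroupTheory.CombinatorialGroupTheory.RandomSclFreeGroupPairingBound
import Literature.GroupTheory.CombinatorialGroupTheory.RandomSclFreeGroupSurfaceBound
import HarnessLib

/-!
# Random rigidity of scl (Calegari–Walker 2013): proofs, part 7 — the deterministic scl lower bound

D. Calegari, A. Walker, *Random rigidity in the free group*, Geom. Topol. 17 (2013)
[CalegariWalker2013], Prop. 5.4: a random word `v` of length `n` has
`scl(v) ≥ (1 − o(1)) · n log(2k−1) / (12 L log n)` with overwhelming probability. The printed proof
certifies this with a small counting quasimorphism; we obtain the same inequality from surfaces: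
`length_div_le_commutatorLength` (part 6) applied to the powers `v^M` of a cyclically reduced word,
and `scl = lim cl(v^M)/M`.

* **`get_flatten_replicate`** — letters of `v^M`.
* **`card_inverseRepeats_pow_le`** — the inverse-repeat windows of `v^M` number at most `M` times
  the CYCLIC inverse-repeat windows of `v`.
* **`stableCommutatorLength_ge_of_isCyclicallyReduced`** — for a non-empty cyclically reduced
  `v ∈ [F, F]` and `ℓ₀ ≥ 1`: `scl(v) ≥ |v| / (12 ℓ₀) − R_cyc(v) / 12`, where `R_cyc(v)` is the
  number of positions `j` of the cyclic word `v` whose cyclic window of length `ℓ₀ + 1` is the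
  inverse of another cyclic window. (Deterministic; the probabilistic input — `R_cyc` is small for
  `ℓ₀ + 1 = Lm`, `L > 1` — is Prop. 2.6.)
* **`conjugator_length_le`**, **`card_cyclicInverseRepeats_le`**,
  **`card_inverseRepeats_middle_le`**, **`card_repeats_middle_le`** — comparison of the cyclic
  statistics of the cyclic reduction `v'` of `v = c v' c⁻¹` with the LINEAR statistics of `v`:
  `|c| ≤ R_lin(v) + ℓ₀` and `R_cyc(v') ≤ R_lin(v) + 2ℓ₀ + ℓ₀ · Rep(v)`, where `R_lin(v)` counts the
  windows `v[i, i+ℓ₀]` equal to the inverse of another window and `Rep(v)` those equal to an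
  earlier window.
* **`stableCommutatorLength_ge_of_isReduced`** — for a non-empty REDUCED `v ∈ [F, F]` and
  `ℓ₀ ≥ 1`: `scl(v) ≥ (|v| − 2(R_lin(v) + ℓ₀)) / (12 ℓ₀) − (R_lin(v) + 2ℓ₀ + ℓ₀ · Rep(v)) / 12`.
  For a random reduced word and `ℓ₀ + 1 = ⌈L log n / log(2k−1)⌉`, `L > 1`, the statistics
  `R_lin`, `Rep` are `o(n / log n)` with overwhelming probability (Props. 2.6, 2.11), giving
  CW Prop. 5.4's `scl(v) ≥ (1 − o(1)) n log(2k−1) / (12 L log n)`.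
-/

noncomputable section

open Filter Topology

namespace Literature.GroupTheory.CombinatorialGroupTheory

section Powers

/-- Letters of `v^M`: position `i` of the concatenation of `M` copies of `v` carries the letter of
`v` at `i mod |v|`. [folklore] -/
theorem get_flatten_replicate {β : Type*} (v : List β) (M i : ℕ)
    (hi : i < (List.replicate M v).flatten.length) :
    (List.replicate M v).flatten.get ⟨i, hi⟩ =
      v.get ⟨i % v.length, Nat.mod_lt _ (by
        have := length_flatten_replicate v M; rcases Nat.eq_zero_or_pos v.length with h | h
        · rw [h, mul_zero] at this; omega
        · exact h)⟩ := by
  induction M generalizing i with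
  | zero => simp at hi
  | succ M ih =>
    have hn : 0 < v.length := by
      have := length_flatten_replicate v (M + 1)
      rcases Nat.eq_zero_or_pos v.length with h | h
      · rw [h, mul_zero] at this; omega
      · exact h
    simp only [List.get_eq_getElem]
    have hW : (List.replicate (M + 1) v).flatten = v ++ (List.replicate M v).flatten := by
      rw [List.replicate_succ, List.flatten_cons]
    rw [List.getElem_of_eq hW]
    by_cases hlt : i < v.length
    · rw [List.getElem_append_left hlt]
      congr 1
      exact (Nat.mod_eq_of_lt hlt).symm
    · rw [not_lt] at hlt
      have hi' : i - v.length < (List.replicate M v).flatten.length := by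
        have := length_flatten_replicate v (M + 1)
        have := length_flatten_replicate v M
        rw [hW, List.length_append] at hi
        omega
      rw [List.getElem_append_right hlt]
      have := ih (i - v.length) hi'
      simp only [List.get_eq_getElem] at this
      rw [this]
      congr 1
      exact (Nat.mod_eq_sub_mod hlt).symm

/-- **Inverse repeats of `v^M` versus cyclic inverse repeats of `v`.** Every window of `v^M` of
length `ℓ₀ + 1` which is the inverse of another window of `v^M` reduces mod `|v|` to a position of
the cyclic word `v` whose cyclic window is the inverse of a cyclic window; each such position has at
most `M` lifts. [folklore] -/
theorem card_inverseRepeats_pow_le {α : Type*} [DecidableEq α] (v : List (α × Bool)) (M ℓ₀ : ℕ) :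
    ((Finset.univ : Finset (Fin ((List.replicate M v).flatten.length - ℓ₀))).filter
        fun i : Fin ((List.replicate M v).flatten.length - ℓ₀) =>
          ∃ i' : Fin ((List.replicate M v).flatten.length - ℓ₀), ∀ q : Fin (ℓ₀ + 1),
            (List.replicate M v).flatten.get ⟨i + q, by omega⟩ =
              (((List.replicate M v).flatten.get ⟨i' + (ℓ₀ - q), by omega⟩).1,
                !((List.replicate M v).flatten.get ⟨i' + (ℓ₀ - q), by omega⟩).2)).card ≤
      M * ((Finset.univ : Finset (Fin v.length)).filter fun j : Fin v.length =>
        ∃ j' : Fin v.length, ∀ q : Fin (ℓ₀ + 1),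
          v.get ⟨((j : ℕ) + q) % v.length, Nat.mod_lt _ (Fin.pos j)⟩ =
            ((v.get ⟨((j' : ℕ) + (ℓ₀ - q)) % v.length, Nat.mod_lt _ (Fin.pos j)⟩).1,
              !(v.get ⟨((j' : ℕ) + (ℓ₀ - q)) % v.length, Nat.mod_lt _ (Fin.pos j)⟩).2)).card := by
  classical
  have hN := length_flatten_replicate v M
  set RW := ((Finset.univ : Finset (Fin ((List.replicate M v).flatten.length - ℓ₀))).filter
        fun i : Fin ((List.replicate M v).flatten.length - ℓ₀) =>
          ∃ i' : Fin ((List.replicate M v).flatten.length - ℓ₀), ∀ q : Fin (ℓ₀ + 1),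
            (List.replicate M v).flatten.get ⟨i + q, by omega⟩ =
              (((List.replicate M v).flatten.get ⟨i' + (ℓ₀ - q), by omega⟩).1,
                !((List.replicate M v).flatten.get ⟨i' + (ℓ₀ - q), by omega⟩).2)) with hRW
  set Rc := ((Finset.univ : Finset (Fin v.length)).filter fun j : Fin v.length =>
        ∃ j' : Fin v.length, ∀ q : Fin (ℓ₀ + 1),
          v.get ⟨((j : ℕ) + q) % v.length, Nat.mod_lt _ (Fin.pos j)⟩ =
            ((v.get ⟨((j' : ℕ) + (ℓ₀ - q)) % v.length, Nat.mod_lt _ (Fin.pos j)⟩).1,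
              !(v.get ⟨((j' : ℕ) + (ℓ₀ - q)) % v.length, Nat.mod_lt _ (Fin.pos j)⟩).2)) with hRc
  rcases Nat.eq_zero_or_pos v.length with hn0 | hn
  · -- empty `v`: no positions at all
    have : RW.card = 0 := by
      rw [Finset.card_eq_zero, Finset.filter_eq_empty_iff]
      intro i _
      have := i.isLt
      have h2 := hN
      rw [hn0, mul_zero] at h2
      omega
    rw [this]
    exact Nat.zero_le _
  -- reduction mod `|v|`
  let red : Fin ((List.replicate M v).flatten.length - ℓ₀) → Fin v.length :=
    fun i => ⟨(i : ℕ) % v.length, Nat.mod_lt _ hn⟩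
  have himage : RW.image red ⊆ Rc := by
    intro j hj
    rw [Finset.mem_image] at hj
    obtain ⟨i, hi, rfl⟩ := hj
    rw [hRW, Finset.mem_filter] at hi
    obtain ⟨_, i', hwin⟩ := hi
    rw [hRc, Finset.mem_filter]
    refine ⟨Finset.mem_univ _, red i', fun q => ?_⟩
    have h1 := hwin q
    rw [get_flatten_replicate, get_flatten_replicate] at h1
    have e1 : (⟨(((red i : Fin v.length) : ℕ) + q) % v.length, Nat.mod_lt _ (Fin.pos (red i))⟩ :
        Fin v.length) = ⟨((i : ℕ) + q) % v.length, Nat.mod_lt _ hn⟩ := by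
      apply Fin.ext
      simp only [red]
      exact Nat.mod_add_mod _ _ _
    have e2 : (⟨(((red i' : Fin v.length) : ℕ) + (ℓ₀ - q)) % v.length,
        Nat.mod_lt _ (Fin.pos (red i))⟩ : Fin v.length) =
        ⟨((i' : ℕ) + (ℓ₀ - q)) % v.length, Nat.mod_lt _ hn⟩ := by
      apply Fin.ext
      simp only [red]
      exact Nat.mod_add_mod _ _ _
    rw [e1, e2]
    exact h1
  -- fibres of `red` on `RW` have at most `M` elements
  have hfib : ∀ j ∈ RW.image red, (RW.filter fun i => red i = j).card ≤ M := by
    intro j _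
    have h := Finset.card_le_card_of_injOn (fun i : Fin ((List.replicate M v).flatten.length - ℓ₀)
      => (i : ℕ) / v.length) (s := RW.filter fun i => red i = j) (t := Finset.range M) ?_ ?_
    · rwa [Finset.card_range] at h
    · intro i _
      rw [Finset.mem_coe, Finset.mem_range, Nat.div_lt_iff_lt_mul hn]
      have := i.isLt
      have h2 := hN
      omega
    · intro i hi i₂ hi₂ h
      rw [Finset.mem_coe, Finset.mem_filter] at hi hi₂
      have hr : (i : ℕ) % v.length = (i₂ : ℕ) % v.length := by
        have := congrArg Fin.val (hi.2.trans hi₂.2.symm)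
        simpa [red] using this
      apply Fin.ext
      simp only at h
      rw [← Nat.div_add_mod (i : ℕ) v.length, ← Nat.div_add_mod (i₂ : ℕ) v.length, h, hr]
  calc RW.card ≤ M * (RW.image red).card := Finset.card_le_mul_card_image RW M hfib
    _ ≤ M * Rc.card := Nat.mul_le_mul_left M (Finset.card_le_card himage)

/-- **The deterministic scl lower bound (after CW Prop. 5.4).** For a non-empty cyclically reduced
word `v` in the commutator subgroup and `ℓ₀ ≥ 1`:
`scl(v) ≥ |v| / (12 ℓ₀) − R_cyc(v) / 12`, where `R_cyc(v)` counts the positions `j` of the cyclic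
word `v` whose cyclic window of length `ℓ₀ + 1` is the inverse of some cyclic window. (From
`length_div_le_commutatorLength` for `W = v^M`, `card_inverseRepeats_pow_le`, and
`scl(v) = lim cl(v^M)/M`.) [cite: CalegariWalker2013, Prop. 5.4 (the inequality; proof here via
Bardakov's formula instead of counting quasimorphisms)] -/
theorem stableCommutatorLength_ge_of_isCyclicallyReduced {α : Type} [DecidableEq α]
    (v : List (α × Bool)) (hv0 : v ≠ []) (hv : FreeGroup.IsCyclicallyReduced v)
    (hcomm : FreeGroup.mk v ∈ commutator (FreeGroup α)) (ℓ₀ : ℕ) (hℓ : 1 ≤ ℓ₀) :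
    (v.length : ℝ) / (12 * ℓ₀) -
        (((Finset.univ : Finset (Fin v.length)).filter fun j : Fin v.length =>
          ∃ j' : Fin v.length, ∀ q : Fin (ℓ₀ + 1),
            v.get ⟨((j : ℕ) + q) % v.length, Nat.mod_lt _ (Fin.pos j)⟩ =
              ((v.get ⟨((j' : ℕ) + (ℓ₀ - q)) % v.length, Nat.mod_lt _ (Fin.pos j)⟩).1,
                !(v.get ⟨((j' : ℕ) + (ℓ₀ - q)) % v.length, Nat.mod_lt _ (Fin.pos j)⟩).2)).card : ℝ)
          / 12 ≤
      stableCommutatorLength (FreeGroup.mk v) := by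
  set Rc := ((Finset.univ : Finset (Fin v.length)).filter fun j : Fin v.length =>
      ∃ j' : Fin v.length, ∀ q : Fin (ℓ₀ + 1),
        v.get ⟨((j : ℕ) + q) % v.length, Nat.mod_lt _ (Fin.pos j)⟩ =
          ((v.get ⟨((j' : ℕ) + (ℓ₀ - q)) % v.length, Nat.mod_lt _ (Fin.pos j)⟩).1,
            !(v.get ⟨((j' : ℕ) + (ℓ₀ - q)) % v.length, Nat.mod_lt _ (Fin.pos j)⟩).2)) with hRc
  have hn : 0 < v.length := List.length_pos_of_ne_nil hv0
  set g := FreeGroup.mk v with hg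
  -- the bound for each power
  have hpow : ∀ M : ℕ, 1 ≤ M →
      (v.length : ℝ) / (12 * ℓ₀) - (Rc.card : ℝ) / 12 - (ℓ₀ : ℝ) / (12 * M) ≤
        (commutatorLength (g ^ M) : ℝ) / M := by
    intro M hM
    set W := (List.replicate M v).flatten with hW
    have hWlen : W.length = M * v.length := length_flatten_replicate v M
    have hW0 : W ≠ [] := by
      intro h
      have := congrArg List.length h
      rw [hWlen, List.length_nil] at this
      exact absurd this (Nat.ne_of_gt (Nat.mul_pos (by omega) hn))
    have hWcyc : FreeGroup.IsCyclicallyReduced W := hv.flatten_replicate M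
    have hWmk : FreeGroup.mk W = g ^ M := mk_flatten_replicate v M
    have hWcomm : FreeGroup.mk W ∈ commutator (FreeGroup α) := by
      rw [hWmk]; exact Subgroup.pow_mem _ hcomm M
    have hmain := length_div_le_commutatorLength W hW0 hWcyc hWcomm ℓ₀ hℓ
    have hRW := card_inverseRepeats_pow_le v M ℓ₀
    rw [hWmk] at hmain
    -- pass to `ℝ`
    have hmainR : ((W.length : ℕ) : ℝ) / ℓ₀ ≤ 12 * (commutatorLength (g ^ M) : ℝ) +
        (((Finset.univ : Finset (Fin (W.length - ℓ₀))).filter fun i : Fin (W.length - ℓ₀) =>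
          ∃ i' : Fin (W.length - ℓ₀), ∀ q : Fin (ℓ₀ + 1), W.get ⟨i + q, by omega⟩ =
            ((W.get ⟨i' + (ℓ₀ - q), by omega⟩).1, !(W.get ⟨i' + (ℓ₀ - q), by omega⟩).2)).card : ℝ)
          + ℓ₀ - 5 := by
      have := (Rat.cast_le (K := ℝ)).mpr hmain
      push_cast at this
      exact this
    have hRWR : ((((Finset.univ : Finset (Fin (W.length - ℓ₀))).filter fun i : Fin (W.length - ℓ₀) =>
          ∃ i' : Fin (W.length - ℓ₀), ∀ q : Fin (ℓ₀ + 1), W.get ⟨i + q, by omega⟩ =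
            ((W.get ⟨i' + (ℓ₀ - q), by omega⟩).1, !(W.get ⟨i' + (ℓ₀ - q), by omega⟩).2)).card
          : ℕ) : ℝ) ≤ (M : ℝ) * (Rc.card : ℝ) := by
      exact_mod_cast hRW
    have hMR : (0 : ℝ) < M := by exact_mod_cast (show 0 < M by omega)
    have hℓR : (0 : ℝ) < ℓ₀ := by exact_mod_cast (show 0 < ℓ₀ by omega)
    have hlenR : ((W.length : ℕ) : ℝ) = (M : ℝ) * (v.length : ℝ) := by
      rw [hWlen]; push_cast; ring
    rw [hlenR] at hmainR
    rw [le_div_iff₀ hMR]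
    rw [div_le_iff₀ hℓR] at hmainR
    have e1 : ((v.length : ℝ) / (12 * ℓ₀) - (Rc.card : ℝ) / 12 - (ℓ₀ : ℝ) / (12 * M)) * M =
        ((M : ℝ) * v.length - M * Rc.card * ℓ₀ - ℓ₀ * ℓ₀) / (12 * ℓ₀) := by
      field_simp
    rw [e1, div_le_iff₀ (by positivity)]
    nlinarith
  -- pass to the limit `scl = lim cl(g^M)/M`
  have hlim := tendsto_commutatorLength_pow_div hcomm
  have hconst : Tendsto (fun M : ℕ => (v.length : ℝ) / (12 * ℓ₀) - (Rc.card : ℝ) / 12 -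
      (ℓ₀ : ℝ) / (12 * (M : ℝ))) atTop
      (𝓝 ((v.length : ℝ) / (12 * ℓ₀) - (Rc.card : ℝ) / 12 - 0)) := by
    refine Tendsto.sub tendsto_const_nhds ?_
    have h1 : Tendsto (fun M : ℕ => (12 : ℝ) * (M : ℝ)) atTop atTop :=
      Tendsto.const_mul_atTop (by norm_num) tendsto_natCast_atTop_atTop
    exact Tendsto.div_atTop tendsto_const_nhds h1
  rw [sub_zero] at hconst
  refine le_of_tendsto_of_tendsto hconst hlim ?_
  rw [Filter.EventuallyLE, Filter.eventually_atTop]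
  exact ⟨1, fun M hM => hpow M hM⟩

end Powers

section CyclicReduction

open FreeGroup

/-- Letters of `invRev c`: position `t` carries the inverse of the letter of `c` at
`|c| − 1 − t`. [folklore] -/
theorem get_invRev {α : Type*} (c : List (α × Bool)) (t : ℕ) (ht : t < c.length) :
    (FreeGroup.invRev c).get ⟨t, by rw [FreeGroup.invRev_length]; exact ht⟩ =
      ((c.get ⟨c.length - 1 - t, by omega⟩).1, !(c.get ⟨c.length - 1 - t, by omega⟩).2) := by
  simp [FreeGroup.invRev, List.getElem_reverse]

/-- Letters of the trailing `invRev c` of `c ++ v' ++ invRev c`. [folklore] -/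
theorem get_append_invRev {α : Type*} (c v' : List (α × Bool)) (t : ℕ) (ht : t < c.length) :
    (c ++ v' ++ FreeGroup.invRev c).get ⟨t + (c ++ v').length, by
        simp [FreeGroup.invRev_length]; omega⟩ =
      ((c.get ⟨c.length - 1 - t, by omega⟩).1, !(c.get ⟨c.length - 1 - t, by omega⟩).2) := by
  rw [← get_invRev c t ht]
  simp only [List.get_eq_getElem]
  exact (List.getElem_append_right' (c ++ v') _).symm

/-- **The conjugator is made of inverse repeats.** If `v = c ++ v' ++ c⁻¹` (as for the cyclic
reduction of a reduced word), then every position `s` with `s + ℓ₀ < |c|` is an inverse-repeat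
position of `v` for windows of length `ℓ₀ + 1`; hence `|c| ≤ R_lin(v) + ℓ₀`. [folklore] -/
theorem conjugator_length_le {α : Type*} [DecidableEq α] (c v' : List (α × Bool)) (ℓ₀ : ℕ) :
    c.length ≤ ((Finset.univ : Finset (Fin ((c ++ v' ++ FreeGroup.invRev c).length - ℓ₀))).filter
      fun i : Fin ((c ++ v' ++ FreeGroup.invRev c).length - ℓ₀) =>
        ∃ i' : Fin ((c ++ v' ++ FreeGroup.invRev c).length - ℓ₀), ∀ q : Fin (ℓ₀ + 1),
          (c ++ v' ++ FreeGroup.invRev c).get ⟨i + q, by omega⟩ =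
            (((c ++ v' ++ FreeGroup.invRev c).get ⟨i' + (ℓ₀ - q), by omega⟩).1,
              !((c ++ v' ++ FreeGroup.invRev c).get ⟨i' + (ℓ₀ - q), by omega⟩).2)).card + ℓ₀ := by
  classical
  have hlen : (c ++ v' ++ FreeGroup.invRev c).length = c.length + v'.length + c.length := by
    simp only [List.length_append, FreeGroup.invRev_length]
  have hlen2 : (c ++ v').length = c.length + v'.length := List.length_append
  set R := ((Finset.univ : Finset (Fin ((c ++ v' ++ FreeGroup.invRev c).length - ℓ₀))).filter
      fun i : Fin ((c ++ v' ++ FreeGroup.invRev c).length - ℓ₀) =>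
        ∃ i' : Fin ((c ++ v' ++ FreeGroup.invRev c).length - ℓ₀), ∀ q : Fin (ℓ₀ + 1),
          (c ++ v' ++ FreeGroup.invRev c).get ⟨i + q, by omega⟩ =
            (((c ++ v' ++ FreeGroup.invRev c).get ⟨i' + (ℓ₀ - q), by omega⟩).1,
              !((c ++ v' ++ FreeGroup.invRev c).get ⟨i' + (ℓ₀ - q), by omega⟩).2)) with hR
  -- the positions `s < |c| - ℓ₀` lie in (the image of) `R`
  have hsub : Finset.range (c.length - ℓ₀) ⊆
      R.image fun i : Fin ((c ++ v' ++ FreeGroup.invRev c).length - ℓ₀) => (i : ℕ) := by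
    intro s hs
    rw [Finset.mem_range] at hs
    have hs' : s < (c ++ v' ++ FreeGroup.invRev c).length - ℓ₀ := by omega
    rw [Finset.mem_image]
    refine ⟨⟨s, hs'⟩, ?_, rfl⟩
    rw [hR, Finset.mem_filter]
    refine ⟨Finset.mem_univ _, ⟨(c ++ v' ++ FreeGroup.invRev c).length - 1 - s - ℓ₀, by omega⟩,
      fun q => ?_⟩
    have hq := q.isLt
    -- the letter at `s + q` lies in `c`
    have e1 : (c ++ v' ++ FreeGroup.invRev c).get ⟨s + q, by omega⟩ = c.get ⟨s + q, by omega⟩ := by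
      simp only [List.get_eq_getElem]
      rw [List.getElem_append_left (by simp only [List.length_append]; omega),
        List.getElem_append_left (by omega)]
    -- the letter at `n - 1 - s - q` lies in `invRev c`
    have e2 : (c ++ v' ++ FreeGroup.invRev c).get
        ⟨(c ++ v' ++ FreeGroup.invRev c).length - 1 - s - ℓ₀ + (ℓ₀ - q), by omega⟩ =
        ((c.get ⟨s + q, by omega⟩).1, !(c.get ⟨s + q, by omega⟩).2) := by
      have h := get_append_invRev c v' (c.length - 1 - (s + q)) (by omega)
      have eidx : (⟨(c.length - 1 - (s + q)) + (c ++ v').length, by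
          simp [FreeGroup.invRev_length]; omega⟩ : Fin (c ++ v' ++ FreeGroup.invRev c).length) =
          ⟨(c ++ v' ++ FreeGroup.invRev c).length - 1 - s - ℓ₀ + (ℓ₀ - q), by omega⟩ :=
        Fin.ext (show (c.length - 1 - (s + q)) + (c ++ v').length =
          (c ++ v' ++ FreeGroup.invRev c).length - 1 - s - ℓ₀ + (ℓ₀ - q) by omega)
      rw [eidx] at h
      rw [h]
      have eidx2 : (⟨c.length - 1 - (c.length - 1 - (s + q)), by omega⟩ : Fin c.length) =
          ⟨s + q, by omega⟩ :=
        Fin.ext (show c.length - 1 - (c.length - 1 - (s + q)) = s + q by omega)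
      rw [eidx2]
    simp only
    rw [e1, e2]
    simp
  have h := (Finset.card_le_card hsub).trans Finset.card_image_le
  rw [Finset.card_range] at h
  omega

/-- **Cyclic versus linear inverse repeats.** For a word `v'` of length `n' ≥ 1` and `ℓ₀`, the
number of positions `j` of the cyclic word `v'` whose cyclic window of length `ℓ₀ + 1` is the
inverse of a cyclic window is at most `ℓ₀` (wrapping `j`) `+ R_lin(v')` (both windows linear)
`+ ℓ₀ · (1 + Rep(v'))` (linear window equal to the inverse of one of the `≤ ℓ₀` wrapping windows:
all its occurrences but the first are repeats of an earlier window). [folklore] -/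
theorem card_cyclicInverseRepeats_le {α : Type*} [DecidableEq α] (v' : List (α × Bool)) (ℓ₀ : ℕ) :
    ((Finset.univ : Finset (Fin v'.length)).filter fun j : Fin v'.length =>
        ∃ j' : Fin v'.length, ∀ q : Fin (ℓ₀ + 1),
          v'.get ⟨((j : ℕ) + q) % v'.length, Nat.mod_lt _ (Fin.pos j)⟩ =
            ((v'.get ⟨((j' : ℕ) + (ℓ₀ - q)) % v'.length, Nat.mod_lt _ (Fin.pos j)⟩).1,
              !(v'.get ⟨((j' : ℕ) + (ℓ₀ - q)) % v'.length, Nat.mod_lt _ (Fin.pos j)⟩).2)).card ≤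
      ℓ₀ +
      ((Finset.univ : Finset (Fin (v'.length - ℓ₀))).filter fun i : Fin (v'.length - ℓ₀) =>
        ∃ i' : Fin (v'.length - ℓ₀), ∀ q : Fin (ℓ₀ + 1), v'.get ⟨i + q, by omega⟩ =
          ((v'.get ⟨i' + (ℓ₀ - q), by omega⟩).1, !(v'.get ⟨i' + (ℓ₀ - q), by omega⟩).2)).card +
      ℓ₀ * (1 + ((Finset.univ : Finset (Fin (v'.length - ℓ₀))).filter fun i : Fin (v'.length - ℓ₀) =>
        ∃ i'' : Fin (v'.length - ℓ₀), i'' < i ∧ ∀ q : Fin (ℓ₀ + 1),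
          v'.get ⟨i'' + q, by omega⟩ = v'.get ⟨i + q, by omega⟩).card) := by
  classical
  set n := v'.length with hn
  set Rc := ((Finset.univ : Finset (Fin v'.length)).filter fun j : Fin v'.length =>
        ∃ j' : Fin v'.length, ∀ q : Fin (ℓ₀ + 1),
          v'.get ⟨((j : ℕ) + q) % v'.length, Nat.mod_lt _ (Fin.pos j)⟩ =
            ((v'.get ⟨((j' : ℕ) + (ℓ₀ - q)) % v'.length, Nat.mod_lt _ (Fin.pos j)⟩).1,
              !(v'.get ⟨((j' : ℕ) + (ℓ₀ - q)) % v'.length, Nat.mod_lt _ (Fin.pos j)⟩).2))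
    with hRc
  set Rl := ((Finset.univ : Finset (Fin (v'.length - ℓ₀))).filter fun i : Fin (v'.length - ℓ₀) =>
        ∃ i' : Fin (v'.length - ℓ₀), ∀ q : Fin (ℓ₀ + 1), v'.get ⟨i + q, by omega⟩ =
          ((v'.get ⟨i' + (ℓ₀ - q), by omega⟩).1, !(v'.get ⟨i' + (ℓ₀ - q), by omega⟩).2))
    with hRl
  set Rp := ((Finset.univ : Finset (Fin (v'.length - ℓ₀))).filter fun i : Fin (v'.length - ℓ₀) =>
        ∃ i'' : Fin (v'.length - ℓ₀), i'' < i ∧ ∀ q : Fin (ℓ₀ + 1),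
          v'.get ⟨i'' + q, by omega⟩ = v'.get ⟨i + q, by omega⟩) with hRp
  -- split `Rc` according to `j` wrapping / partner wrapping
  set A := Rc.filter fun j : Fin v'.length => v'.length - ℓ₀ ≤ (j : ℕ) with hA
  set B := Rc.filter fun j : Fin v'.length => (j : ℕ) < v'.length - ℓ₀ ∧
      ∃ j' : Fin v'.length, (j' : ℕ) < v'.length - ℓ₀ ∧ ∀ q : Fin (ℓ₀ + 1),
        v'.get ⟨((j : ℕ) + q) % v'.length, Nat.mod_lt _ (Fin.pos j)⟩ =
          ((v'.get ⟨((j' : ℕ) + (ℓ₀ - q)) % v'.length, Nat.mod_lt _ (Fin.pos j)⟩).1,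
            !(v'.get ⟨((j' : ℕ) + (ℓ₀ - q)) % v'.length, Nat.mod_lt _ (Fin.pos j)⟩).2) with hB
  set C := Rc.filter fun j : Fin v'.length => (j : ℕ) < v'.length - ℓ₀ ∧
      ∃ j' : Fin v'.length, v'.length - ℓ₀ ≤ (j' : ℕ) ∧ ∀ q : Fin (ℓ₀ + 1),
        v'.get ⟨((j : ℕ) + q) % v'.length, Nat.mod_lt _ (Fin.pos j)⟩ =
          ((v'.get ⟨((j' : ℕ) + (ℓ₀ - q)) % v'.length, Nat.mod_lt _ (Fin.pos j)⟩).1,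
            !(v'.get ⟨((j' : ℕ) + (ℓ₀ - q)) % v'.length, Nat.mod_lt _ (Fin.pos j)⟩).2) with hC
  have hcover : Rc ⊆ A ∪ B ∪ C := by
    intro j hj
    rw [Finset.mem_union, Finset.mem_union]
    by_cases hwrap : v'.length - ℓ₀ ≤ (j : ℕ)
    · exact Or.inl (Or.inl (Finset.mem_filter.mpr ⟨hj, hwrap⟩))
    · rw [not_le] at hwrap
      have hj' := hj
      rw [hRc, Finset.mem_filter] at hj'
      obtain ⟨_, j', hwin⟩ := hj'
      by_cases hw' : (j' : ℕ) < v'.length - ℓ₀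
      · exact Or.inl (Or.inr (Finset.mem_filter.mpr ⟨hj, hwrap, j', hw', hwin⟩))
      · rw [not_lt] at hw'
        exact Or.inr (Finset.mem_filter.mpr ⟨hj, hwrap, j', hw', hwin⟩)
  -- (A) at most `ℓ₀` wrapping positions
  have hAcard : A.card ≤ ℓ₀ := by
    have h := Finset.card_le_card_of_injOn (fun j : Fin v'.length => (j : ℕ) - (v'.length - ℓ₀))
      (s := A) (t := Finset.range ℓ₀) ?_ ?_
    · rwa [Finset.card_range] at h
    · intro j hj
      rw [Finset.mem_coe, hA, Finset.mem_filter] at hj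
      rw [Finset.mem_coe, Finset.mem_range]
      have := j.isLt
      show (j : ℕ) - (v'.length - ℓ₀) < ℓ₀
      omega
    · intro j hj j₂ hj₂ h
      rw [Finset.mem_coe, hA, Finset.mem_filter] at hj hj₂
      apply Fin.ext
      simp only at h
      omega
  -- linear windows at non-wrapping positions are ordinary windows
  have hlin : ∀ (j : ℕ) (hj : j < v'.length - ℓ₀) (r : ℕ) (hr : r ≤ ℓ₀),
      (⟨(j + r) % v'.length, Nat.mod_lt _ (by omega)⟩ : Fin v'.length) = ⟨j + r, by omega⟩ := by
    intro j hj r hr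
    exact Fin.ext (Nat.mod_eq_of_lt (by omega))
  -- (B) both linear: an inverse repeat of the word `v'`
  have hBcard : B.card ≤ Rl.card := by
    have hsub : B.image (fun j : Fin v'.length => (j : ℕ)) ⊆
        Rl.image (fun i : Fin (v'.length - ℓ₀) => (i : ℕ)) := by
      intro x hx
      rw [Finset.mem_image] at hx
      obtain ⟨j, hj, rfl⟩ := hx
      rw [hB, Finset.mem_filter] at hj
      obtain ⟨_, hjlt, j', hj'lt, hwin⟩ := hj
      rw [Finset.mem_image]
      refine ⟨⟨j, hjlt⟩, ?_, rfl⟩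
      rw [hRl, Finset.mem_filter]
      refine ⟨Finset.mem_univ _, ⟨j', hj'lt⟩, fun q => ?_⟩
      have h1 := hwin q
      rw [hlin j hjlt q (by omega), hlin j' hj'lt (ℓ₀ - q) (by omega)] at h1
      exact h1
    calc B.card = (B.image fun j : Fin v'.length => (j : ℕ)).card :=
          (Finset.card_image_of_injective _ Fin.val_injective).symm
      _ ≤ (Rl.image fun i : Fin (v'.length - ℓ₀) => (i : ℕ)).card := Finset.card_le_card hsub
      _ = Rl.card := Finset.card_image_of_injective _ Fin.val_injective
  -- (C) partner wrapping: for each of the `≤ ℓ₀` wrapping `j'`, the occurrences of the fixed word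
  have hCcard : C.card ≤ ℓ₀ * (1 + Rp.card) := by
    rcases C.eq_empty_or_nonempty with hC0 | hCne
    · rw [hC0, Finset.card_empty]; exact Nat.zero_le _
    obtain ⟨jC, hjC⟩ := hCne
    have hnpos : 0 < v'.length := Fin.pos jC
    -- the `ℓ₀` candidate words: inverses of the wrapping windows
    let u : ℕ → Fin (ℓ₀ + 1) → α × Bool := fun t q =>
      ((v'.get ⟨((v'.length - ℓ₀ + t) + (ℓ₀ - q)) % v'.length, Nat.mod_lt _ hnpos⟩).1,
        !(v'.get ⟨((v'.length - ℓ₀ + t) + (ℓ₀ - q)) % v'.length, Nat.mod_lt _ hnpos⟩).2)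
    let Ct : ℕ → Finset (Fin v'.length) := fun t => Finset.univ.filter fun j : Fin v'.length =>
      (j : ℕ) < v'.length - ℓ₀ ∧ ∀ q : Fin (ℓ₀ + 1),
        v'.get ⟨((j : ℕ) + q) % v'.length, Nat.mod_lt _ (Fin.pos j)⟩ = u t q
    have hCsub : C ⊆ (Finset.range ℓ₀).biUnion Ct := by
      intro j hj
      rw [hC, Finset.mem_filter] at hj
      obtain ⟨_, hjlt, j', hj'ge, hwin⟩ := hj
      rw [Finset.mem_biUnion]
      have hj'lt := j'.isLt
      refine ⟨(j' : ℕ) - (v'.length - ℓ₀), Finset.mem_range.mpr (by omega), ?_⟩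
      rw [Finset.mem_filter]
      refine ⟨Finset.mem_univ _, hjlt, fun q => ?_⟩
      rw [hwin q]
      have e : v'.length - ℓ₀ + ((j' : ℕ) - (v'.length - ℓ₀)) = j' := by omega
      simp only [u, e]
    have hterm : ∀ t ∈ Finset.range ℓ₀, (Ct t).card ≤ 1 + Rp.card := by
      intro t _
      rcases (Ct t).eq_empty_or_nonempty with hempty | hne
      · rw [hempty, Finset.card_empty]; omega
      -- all elements of `Ct t` but its minimum are repeats of the minimum
      have hj₀mem := Finset.min'_mem (Ct t) hne
      have hsub : (Ct t).erase ((Ct t).min' hne) ⊆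
          Rp.image (fun i : Fin (v'.length - ℓ₀) => (⟨i, by omega⟩ : Fin v'.length)) := by
        intro j hj
        rw [Finset.mem_erase] at hj
        obtain ⟨hne0, hjCt⟩ := hj
        have hlt : (Ct t).min' hne < j := lt_of_le_of_ne (Finset.min'_le (Ct t) j hjCt) (Ne.symm hne0)
        rw [Finset.mem_filter] at hjCt hj₀mem
        obtain ⟨_, hjlt, hwin⟩ := hjCt
        obtain ⟨_, hj₀lt, hwin₀⟩ := hj₀mem
        rw [Finset.mem_image]
        refine ⟨⟨j, hjlt⟩, ?_, Fin.ext rfl⟩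
        rw [hRp, Finset.mem_filter]
        refine ⟨Finset.mem_univ _, ⟨(Ct t).min' hne, hj₀lt⟩, hlt, fun q => ?_⟩
        have e1 := hwin q
        have e0 := hwin₀ q
        rw [hlin j hjlt q (by omega)] at e1
        rw [hlin ((Ct t).min' hne) hj₀lt q (by omega)] at e0
        exact e0.trans e1.symm
      have hcard := Finset.card_le_card hsub
      rw [Finset.card_erase_of_mem (Finset.min'_mem (Ct t) hne)] at hcard
      have := Finset.card_image_le (s := Rp)
        (f := fun i : Fin (v'.length - ℓ₀) => (⟨i, by omega⟩ : Fin v'.length))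
      have hpos := Finset.card_pos.mpr hne
      omega
    refine (Finset.card_le_card hCsub).trans (Finset.card_biUnion_le.trans ?_)
    calc ∑ t ∈ Finset.range ℓ₀, (Ct t).card ≤ ∑ _t ∈ Finset.range ℓ₀, (1 + Rp.card) :=
          Finset.sum_le_sum hterm
      _ = ℓ₀ * (1 + Rp.card) := by rw [Finset.sum_const, Finset.card_range, smul_eq_mul]
  calc Rc.card ≤ (A ∪ B ∪ C).card := Finset.card_le_card hcover
    _ ≤ A.card + B.card + C.card :=
        (Finset.card_union_le _ _).trans (by have := Finset.card_union_le A B; omega)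
    _ ≤ ℓ₀ + Rl.card + ℓ₀ * (1 + Rp.card) := by omega

/-- Windows of a middle factor: the letter of `c ++ v' ++ d` at `j + |c|` is the letter of `v'`
at `j`. [folklore] -/
theorem get_append_middle {β : Type*} (c v' d : List β) (j : ℕ) (hj : j < v'.length) :
    (c ++ v' ++ d).get ⟨j + c.length, by simp; omega⟩ = v'.get ⟨j, hj⟩ := by
  simp only [List.get_eq_getElem]
  rw [List.getElem_append_left (by simp; omega)]
  exact (List.getElem_append_right' c hj).symm

/-- **Inverse repeats are monotone under passing to a middle factor.** [folklore] -/
theorem card_inverseRepeats_middle_le {α : Type*} [DecidableEq α] (c v' d : List (α × Bool))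
    (ℓ₀ : ℕ) :
    ((Finset.univ : Finset (Fin (v'.length - ℓ₀))).filter fun i : Fin (v'.length - ℓ₀) =>
        ∃ i' : Fin (v'.length - ℓ₀), ∀ q : Fin (ℓ₀ + 1), v'.get ⟨i + q, by omega⟩ =
          ((v'.get ⟨i' + (ℓ₀ - q), by omega⟩).1, !(v'.get ⟨i' + (ℓ₀ - q), by omega⟩).2)).card ≤
      ((Finset.univ : Finset (Fin ((c ++ v' ++ d).length - ℓ₀))).filter
        fun i : Fin ((c ++ v' ++ d).length - ℓ₀) =>
          ∃ i' : Fin ((c ++ v' ++ d).length - ℓ₀), ∀ q : Fin (ℓ₀ + 1),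
            (c ++ v' ++ d).get ⟨i + q, by omega⟩ =
              (((c ++ v' ++ d).get ⟨i' + (ℓ₀ - q), by omega⟩).1,
                !((c ++ v' ++ d).get ⟨i' + (ℓ₀ - q), by omega⟩).2)).card := by
  classical
  have hlen : (c ++ v' ++ d).length = c.length + v'.length + d.length := by
    simp only [List.length_append]
  refine Finset.card_le_card_of_injOn (fun i : Fin (v'.length - ℓ₀) =>
    (⟨(i : ℕ) + c.length, by omega⟩ : Fin ((c ++ v' ++ d).length - ℓ₀))) ?_ ?_
  · intro i hi
    rw [Finset.mem_coe, Finset.mem_filter] at hi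
    obtain ⟨_, i', hwin⟩ := hi
    rw [Finset.mem_coe, Finset.mem_filter]
    refine ⟨Finset.mem_univ _, ⟨(i' : ℕ) + c.length, by omega⟩, fun q => ?_⟩
    have h1 := hwin q
    have e1 : (⟨((⟨(i : ℕ) + c.length, by omega⟩ : Fin ((c ++ v' ++ d).length - ℓ₀)) : ℕ) + q, by
        omega⟩ : Fin (c ++ v' ++ d).length) = ⟨((i : ℕ) + q) + c.length, by omega⟩ :=
      Fin.ext (show (i : ℕ) + c.length + q = (i : ℕ) + q + c.length by omega)
    have e2 : (⟨((⟨(i' : ℕ) + c.length, by omega⟩ : Fin ((c ++ v' ++ d).length - ℓ₀)) : ℕ) +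
        (ℓ₀ - q), by omega⟩ : Fin (c ++ v' ++ d).length) =
        ⟨((i' : ℕ) + (ℓ₀ - q)) + c.length, by omega⟩ :=
      Fin.ext (show (i' : ℕ) + c.length + (ℓ₀ - q) = (i' : ℕ) + (ℓ₀ - q) + c.length by omega)
    rw [e1, e2, get_append_middle c v' d _ (by omega), get_append_middle c v' d _ (by omega)]
    exact h1
  · intro i _ i₂ _ h
    apply Fin.ext
    have := congrArg Fin.val h
    simp only at this
    omega

/-- **Repeats are monotone under passing to a middle factor.** [folklore] -/
theorem card_repeats_middle_le {α : Type*} [DecidableEq α] (c v' d : List (α × Bool)) (ℓ₀ : ℕ) :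
    ((Finset.univ : Finset (Fin (v'.length - ℓ₀))).filter fun i : Fin (v'.length - ℓ₀) =>
        ∃ i'' : Fin (v'.length - ℓ₀), i'' < i ∧ ∀ q : Fin (ℓ₀ + 1),
          v'.get ⟨i'' + q, by omega⟩ = v'.get ⟨i + q, by omega⟩).card ≤
      ((Finset.univ : Finset (Fin ((c ++ v' ++ d).length - ℓ₀))).filter
        fun i : Fin ((c ++ v' ++ d).length - ℓ₀) =>
          ∃ i'' : Fin ((c ++ v' ++ d).length - ℓ₀), i'' < i ∧ ∀ q : Fin (ℓ₀ + 1),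
            (c ++ v' ++ d).get ⟨i'' + q, by omega⟩ = (c ++ v' ++ d).get ⟨i + q, by omega⟩).card := by
  classical
  have hlen : (c ++ v' ++ d).length = c.length + v'.length + d.length := by
    simp only [List.length_append]
  refine Finset.card_le_card_of_injOn (fun i : Fin (v'.length - ℓ₀) =>
    (⟨(i : ℕ) + c.length, by omega⟩ : Fin ((c ++ v' ++ d).length - ℓ₀))) ?_ ?_
  · intro i hi
    rw [Finset.mem_coe, Finset.mem_filter] at hi
    obtain ⟨_, i'', hlt, hwin⟩ := hi
    rw [Finset.mem_coe, Finset.mem_filter]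
    refine ⟨Finset.mem_univ _, ⟨(i'' : ℕ) + c.length, by omega⟩, ?_, fun q => ?_⟩
    · have : (i'' : ℕ) < i := hlt
      show (⟨(i'' : ℕ) + c.length, _⟩ : Fin _) < ⟨(i : ℕ) + c.length, _⟩
      rw [Fin.mk_lt_mk]
      omega
    have h1 := hwin q
    have e1 : (⟨((⟨(i : ℕ) + c.length, by omega⟩ : Fin ((c ++ v' ++ d).length - ℓ₀)) : ℕ) + q, by
        omega⟩ : Fin (c ++ v' ++ d).length) = ⟨((i : ℕ) + q) + c.length, by omega⟩ :=
      Fin.ext (show (i : ℕ) + c.length + q = (i : ℕ) + q + c.length by omega)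
    have e2 : (⟨((⟨(i'' : ℕ) + c.length, by omega⟩ : Fin ((c ++ v' ++ d).length - ℓ₀)) : ℕ) + q, by
        omega⟩ : Fin (c ++ v' ++ d).length) = ⟨((i'' : ℕ) + q) + c.length, by omega⟩ :=
      Fin.ext (show (i'' : ℕ) + c.length + q = (i'' : ℕ) + q + c.length by omega)
    rw [e1, e2, get_append_middle c v' d _ (by omega), get_append_middle c v' d _ (by omega)]
    exact h1
  · intro i _ i₂ _ h
    apply Fin.ext
    have := congrArg Fin.val h
    simp only at this
    omega

/-- **The deterministic scl lower bound for a conjugate `c v' c⁻¹`.** For `v'` non-empty,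
cyclically reduced, in the commutator subgroup, and `w = c ++ v' ++ c⁻¹`, `ℓ₀ ≥ 1`:
`scl(w) ≥ (|w| − 2(R_lin(w) + ℓ₀)) / (12 ℓ₀) − (R_lin(w) + 2ℓ₀ + ℓ₀ · Rep(w)) / 12`, where
`R_lin(w)` counts the windows of `w` of length `ℓ₀ + 1` equal to the inverse of another window and
`Rep(w)` those equal to an earlier window. [cite: CalegariWalker2013, Prop. 5.4 (inequality)] -/
theorem stableCommutatorLength_ge_conj {α : Type} [DecidableEq α] (c v' w : List (α × Bool))
    (hw : w = c ++ v' ++ FreeGroup.invRev c)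
    (hv0 : v' ≠ []) (hv : FreeGroup.IsCyclicallyReduced v')
    (hcomm : FreeGroup.mk v' ∈ commutator (FreeGroup α)) (ℓ₀ : ℕ) (hℓ : 1 ≤ ℓ₀) :
    ((w.length : ℝ) -
        2 * ((((Finset.univ : Finset (Fin (w.length - ℓ₀))).filter fun i : Fin (w.length - ℓ₀) =>
            ∃ i' : Fin (w.length - ℓ₀), ∀ q : Fin (ℓ₀ + 1), w.get ⟨i + q, by omega⟩ =
              ((w.get ⟨i' + (ℓ₀ - q), by omega⟩).1, !(w.get ⟨i' + (ℓ₀ - q), by omega⟩).2)).card : ℝ)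
          + ℓ₀)) / (12 * ℓ₀) -
      ((((Finset.univ : Finset (Fin (w.length - ℓ₀))).filter fun i : Fin (w.length - ℓ₀) =>
            ∃ i' : Fin (w.length - ℓ₀), ∀ q : Fin (ℓ₀ + 1), w.get ⟨i + q, by omega⟩ =
              ((w.get ⟨i' + (ℓ₀ - q), by omega⟩).1, !(w.get ⟨i' + (ℓ₀ - q), by omega⟩).2)).card : ℝ)
        + 2 * ℓ₀ + ℓ₀ *
        (((Finset.univ : Finset (Fin (w.length - ℓ₀))).filter fun i : Fin (w.length - ℓ₀) =>
            ∃ i'' : Fin (w.length - ℓ₀), i'' < i ∧ ∀ q : Fin (ℓ₀ + 1),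
              w.get ⟨i'' + q, by omega⟩ = w.get ⟨i + q, by omega⟩).card : ℝ)) / 12 ≤
      stableCommutatorLength (FreeGroup.mk w) := by
  subst hw
  set w := c ++ v' ++ FreeGroup.invRev c with hw
  set Rl := ((Finset.univ : Finset (Fin (w.length - ℓ₀))).filter fun i : Fin (w.length - ℓ₀) =>
      ∃ i' : Fin (w.length - ℓ₀), ∀ q : Fin (ℓ₀ + 1), w.get ⟨i + q, by omega⟩ =
        ((w.get ⟨i' + (ℓ₀ - q), by omega⟩).1, !(w.get ⟨i' + (ℓ₀ - q), by omega⟩).2)) with hRl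
  set Rp := ((Finset.univ : Finset (Fin (w.length - ℓ₀))).filter fun i : Fin (w.length - ℓ₀) =>
      ∃ i'' : Fin (w.length - ℓ₀), i'' < i ∧ ∀ q : Fin (ℓ₀ + 1),
        w.get ⟨i'' + q, by omega⟩ = w.get ⟨i + q, by omega⟩) with hRp
  show ((w.length : ℝ) - 2 * ((Rl.card : ℝ) + ℓ₀)) / (12 * ℓ₀) -
      ((Rl.card : ℝ) + 2 * ℓ₀ + ℓ₀ * (Rp.card : ℝ)) / 12 ≤ stableCommutatorLength (FreeGroup.mk w)
  -- `w` is a conjugate of `v'`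
  have hmk : FreeGroup.mk w = FreeGroup.mk c * FreeGroup.mk v' * (FreeGroup.mk c)⁻¹ := by
    rw [hw, ← FreeGroup.mul_mk, ← FreeGroup.mul_mk, FreeGroup.inv_mk]
  rw [hmk, stableCommutatorLength_conj]
  -- the bound for `v'`
  have hmain := stableCommutatorLength_ge_of_isCyclicallyReduced v' hv0 hv hcomm ℓ₀ hℓ
  have hcyc := card_cyclicInverseRepeats_le v' ℓ₀
  have hRl' := card_inverseRepeats_middle_le c v' (FreeGroup.invRev c) ℓ₀
  have hRp' := card_repeats_middle_le c v' (FreeGroup.invRev c) ℓ₀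
  have hc := conjugator_length_le c v' ℓ₀
  have hlen : w.length = c.length + v'.length + c.length := by
    simp only [hw, List.length_append, FreeGroup.invRev_length]
  refine le_trans ?_ hmain
  -- arithmetic
  have hℓR : (0 : ℝ) < ℓ₀ := by exact_mod_cast (show 0 < ℓ₀ by omega)
  -- align the statistics of `w` with `Rl`, `Rp`
  have hRl'' : ((Finset.univ : Finset (Fin (v'.length - ℓ₀))).filter fun i : Fin (v'.length - ℓ₀) =>
      ∃ i' : Fin (v'.length - ℓ₀), ∀ q : Fin (ℓ₀ + 1), v'.get ⟨i + q, by omega⟩ =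
        ((v'.get ⟨i' + (ℓ₀ - q), by omega⟩).1, !(v'.get ⟨i' + (ℓ₀ - q), by omega⟩).2)).card ≤
      Rl.card := hRl'
  have hRp'' : ((Finset.univ : Finset (Fin (v'.length - ℓ₀))).filter fun i : Fin (v'.length - ℓ₀) =>
      ∃ i'' : Fin (v'.length - ℓ₀), i'' < i ∧ ∀ q : Fin (ℓ₀ + 1),
        v'.get ⟨i'' + q, by omega⟩ = v'.get ⟨i + q, by omega⟩).card ≤ Rp.card := hRp'
  have hc' : c.length ≤ Rl.card + ℓ₀ := hc
  have hcycR : ((((Finset.univ : Finset (Fin v'.length)).filter fun j : Fin v'.length =>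
      ∃ j' : Fin v'.length, ∀ q : Fin (ℓ₀ + 1),
        v'.get ⟨((j : ℕ) + q) % v'.length, Nat.mod_lt _ (Fin.pos j)⟩ =
          ((v'.get ⟨((j' : ℕ) + (ℓ₀ - q)) % v'.length, Nat.mod_lt _ (Fin.pos j)⟩).1,
            !(v'.get ⟨((j' : ℕ) + (ℓ₀ - q)) % v'.length, Nat.mod_lt _ (Fin.pos j)⟩).2)).card : ℕ)
        : ℝ) ≤ (ℓ₀ : ℝ) + (Rl.card : ℝ) + (ℓ₀ : ℝ) * (1 + (Rp.card : ℝ)) := by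
    have h := hcyc.trans (show _ ≤ ℓ₀ + Rl.card + ℓ₀ * (1 + Rp.card) by
      have := Nat.mul_le_mul_left ℓ₀ (Nat.add_le_add_left hRp'' 1)
      omega)
    exact_mod_cast h
  have hvlen : (w.length : ℝ) - 2 * ((Rl.card : ℝ) + ℓ₀) ≤ (v'.length : ℝ) := by
    have h : w.length ≤ v'.length + 2 * (Rl.card + ℓ₀) := by omega
    have h' : (w.length : ℝ) ≤ (v'.length : ℝ) + 2 * ((Rl.card : ℝ) + ℓ₀) := by exact_mod_cast h
    linarith
  have h1 : ((w.length : ℝ) - 2 * ((Rl.card : ℝ) + ℓ₀)) / (12 * ℓ₀) ≤ (v'.length : ℝ) / (12 * ℓ₀) :=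
    div_le_div_of_nonneg_right hvlen (by positivity)
  have h2 : ((((Finset.univ : Finset (Fin v'.length)).filter fun j : Fin v'.length =>
      ∃ j' : Fin v'.length, ∀ q : Fin (ℓ₀ + 1),
        v'.get ⟨((j : ℕ) + q) % v'.length, Nat.mod_lt _ (Fin.pos j)⟩ =
          ((v'.get ⟨((j' : ℕ) + (ℓ₀ - q)) % v'.length, Nat.mod_lt _ (Fin.pos j)⟩).1,
            !(v'.get ⟨((j' : ℕ) + (ℓ₀ - q)) % v'.length, Nat.mod_lt _ (Fin.pos j)⟩).2)).card : ℕ)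
        : ℝ) / 12 ≤ ((Rl.card : ℝ) + 2 * ℓ₀ + ℓ₀ * (Rp.card : ℝ)) / 12 := by
    apply div_le_div_of_nonneg_right _ (by norm_num)
    linarith
  linarith

/-- **The deterministic scl lower bound for a reduced word (after CW Prop. 5.4).** For a non-empty
reduced word `v` in the commutator subgroup and `ℓ₀ ≥ 1`:
`scl(v) ≥ (|v| − 2(R_lin(v) + ℓ₀)) / (12 ℓ₀) − (R_lin(v) + 2ℓ₀ + ℓ₀ · Rep(v)) / 12`, where
`R_lin(v)` is the number of windows `v[i, i+ℓ₀]` equal to the inverse of another window and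
`Rep(v)` the number of windows equal to an earlier window (cyclic reduction `v = c v' c⁻¹`,
`scl(v) = scl(v')`, `stableCommutatorLength_ge_of_isCyclicallyReduced` for `v'`, and the
comparison of the cyclic statistics of `v'` with the linear statistics of `v`).
[cite: CalegariWalker2013, Prop. 5.4 (the inequality; deterministic form)] -/
theorem stableCommutatorLength_ge_of_isReduced {α : Type} [DecidableEq α] (v : List (α × Bool))
    (hv0 : v ≠ []) (hv : FreeGroup.IsReduced v)
    (hcomm : FreeGroup.mk v ∈ commutator (FreeGroup α)) (ℓ₀ : ℕ) (hℓ : 1 ≤ ℓ₀) :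
    ((v.length : ℝ) -
        2 * ((((Finset.univ : Finset (Fin (v.length - ℓ₀))).filter fun i : Fin (v.length - ℓ₀) =>
            ∃ i' : Fin (v.length - ℓ₀), ∀ q : Fin (ℓ₀ + 1), v.get ⟨i + q, by omega⟩ =
              ((v.get ⟨i' + (ℓ₀ - q), by omega⟩).1, !(v.get ⟨i' + (ℓ₀ - q), by omega⟩).2)).card : ℝ)
          + ℓ₀)) / (12 * ℓ₀) -
      ((((Finset.univ : Finset (Fin (v.length - ℓ₀))).filter fun i : Fin (v.length - ℓ₀) =>
            ∃ i' : Fin (v.length - ℓ₀), ∀ q : Fin (ℓ₀ + 1), v.get ⟨i + q, by omega⟩ =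
              ((v.get ⟨i' + (ℓ₀ - q), by omega⟩).1, !(v.get ⟨i' + (ℓ₀ - q), by omega⟩).2)).card : ℝ)
        + 2 * ℓ₀ + ℓ₀ *
        (((Finset.univ : Finset (Fin (v.length - ℓ₀))).filter fun i : Fin (v.length - ℓ₀) =>
            ∃ i'' : Fin (v.length - ℓ₀), i'' < i ∧ ∀ q : Fin (ℓ₀ + 1),
              v.get ⟨i'' + q, by omega⟩ = v.get ⟨i + q, by omega⟩).card : ℝ)) / 12 ≤
      stableCommutatorLength (FreeGroup.mk v) := by
  have hdec := FreeGroup.reduceCyclically.conj_conjugator_reduceCyclically v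
  set c := FreeGroup.reduceCyclically.conjugator v with hc
  set v' := FreeGroup.reduceCyclically v with hv'
  have hcyc : FreeGroup.IsCyclicallyReduced v' := FreeGroup.reduceCyclically.isCyclicallyReduced hv
  -- `v'` is non-empty since `v` is reduced and non-empty
  have hv'0 : v' ≠ [] := by
    intro h0
    rw [h0, List.append_nil] at hdec
    by_cases hc0 : c = []
    · rw [hc0] at hdec
      simp [FreeGroup.invRev] at hdec
      exact hv0 hdec
    · have := not_isReduced_append_invRev hc0
      rw [hdec] at this
      exact this hv
  -- `mk v'` is in the commutator subgroup (a conjugate of `mk v`)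
  have hmk : FreeGroup.mk v = FreeGroup.mk c * FreeGroup.mk v' * (FreeGroup.mk c)⁻¹ := by
    conv_lhs => rw [← hdec]
    rw [← FreeGroup.mul_mk, ← FreeGroup.mul_mk, FreeGroup.inv_mk]
  have hcomm' : FreeGroup.mk v' ∈ commutator (FreeGroup α) := by
    have h : FreeGroup.mk v' = (FreeGroup.mk c)⁻¹ * FreeGroup.mk v * (FreeGroup.mk c)⁻¹⁻¹ := by
      rw [hmk]; group
    rw [h]
    exact Subgroup.Normal.conj_mem inferInstance _ hcomm _
  exact stableCommutatorLength_ge_conj c v' v hdec.symm hv'0 hcyc hcomm' ℓ₀ hℓ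

end CyclicReduction



end Literature.GroupTheory.CombinatorialGroupTheory

end
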